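import Summits.QuantumFields.YangMills.Theorems.BalabanUVNodesN16SlotKeyWitnesses
import Summits.QuantumFields.BalabanUV.T4Continuum.Support.NE7InteriorInduction
import Summits.QuantumFields.BalabanUV.T4Continuum.Support.MinimalActionExistence
import HarnessLib

/-!
# Route «BalabanUVNodes» (K3⁷ `SpineGivenEndpointR13SepCoPH`, stmt-QuantumFields-20544), DAG node N16 = NE3, in-edge N07 → N16 — THE RE-KEYED N07 IN-EDGE
# (slot key (T9ˢ) ∧ (T8)) IS FREE ON THE WHOLE FLAT MODULI `sfClass d L N 0 0`, AND ITS EXISTENCE HALF (8) HOLDS AT THE k-DEPENDENT RADIUS `ε₁·L^{2(k+1)}`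
# (the iterated slice pullback is an exact right inverse of the k-fold average (43))

Cell `pub-ymgap`, width seat `pub-ymgap-dag-n16-w2` (director-ym №197 ∕ HUMAN RULING D-0149), generation 5, file 1 of this generation (lineage: g4 `…N16Thm1AtTorusVPSmallCubes[Prep∕Consequences]`
p607834∕p608145∕p609910∕p611145 — the rank-two refutation of the OLD all-cube in-edge `stub_thm1At`; g4 `…LettersOfLettersB9SrcAllTorusSlot` p613986 ∕ `…PinnedLooseMatchOfLettersB9SrcSlot`
p616553 — the slot-keyed letters-currency producers).  `--kind proof --supports stmt-QuantumFields-20544 --as helper` (count-neutral).  `bears_on: R4∕N16 · edge N07 → N16`.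
THEOREMS ONLY (0 `def`, 0 `sorry`, standard axioms); everything BY NAME over landed modules: the cell `pub-balaban`'s slice pullback `SmoothRefineBlocks.slicePull` with
`NE7InteriorInduction` §1–§2 (unitary ∕ periodic ∕ same plaquette radius ∕ `avgIter L (slicePull L U) (k+1) = avgIter L U k` ∕ admissibility), its compactness theorem
`MinimalActionExistence.exists_isMinimiser_of_nonempty`, its flat-class lemmas `NE3EnergyRateFlatClass.hol_plaqWord_eq_one_of_levelAction_eq_zero` ∕
`exists_unitary_gauge_eq_gaugeAct_flatCfg`, and dag-n16-w1's file 11 `…N16SlotKeyWitnesses` (`lipGauge_gaugeAct_flatCfg`, `regularity_torusVP_lipGauge_of_zero`; p612064).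

THE SLOT KEY (dag-n16-w1 g5 file 9 §1, after this seat's refutation p608145 of leaf-06's all-cube torus reading): (T9ˢ) for every run `k+1`, every `0 < ε₁ ≤ a₁`, every loose
datum `V ∈ sfClass d L N ε₁ 0`, every minimiser `U` of the Wilson action over `sfClass d L N (B₃ε₁) (k+1)` at `V` and every site `x`, r2's
`B11.Regularity (torusVP d L N G (k+1)) B₃ B₄ ε₁ U (x, L^{k+1} − 1 + L^{k+1} + 2)`; (T8) such a minimiser exists.  dag-n16-w1 file 11 inhabits both on the ONE datum `{flatCfg}`; file 12
(`…N16SlotKeyNormalForm` p615276) shows (T8) ⟺ «the admissible set is non-empty».  THIS FILE: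

* §0 THE FLAT MODULI IN WORDS.  `sfClass d L N 0 0 = {V | unitary, N-periodic, every unit plaquette variable = 1}` (`mem_sfClass_zero_zero_iff`; `smallField_zero_iff_flat`).  It holds
  `flatCfg`, every pure gauge `1^{g}` (`g` unitary, `N`-periodic) and the CONSTANT COMMUTING data `V(x, κ) = c_κ` (`constCfg_mem_sfClass_zero`) — flat connections whose holonomy `c_κ^N`
  along a torus cycle need not be `1`, so the moduli is STRICTLY larger than file 11's singleton and than the periodic pure-gauge orbit of `1` (`constCfg_ne_gaugeAct_flatCfg`:
  an `N`-periodic pure gauge of `1` has trivial cycle holonomy, a constant datum has `c_κ^N`).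
* §1 THE ITERATED SLICE PULLBACK `(slicePull L)^[k] V` (coarse bond on the last slice of every block, `1` inside, iterated): unitary, `(N·L^k)`-periodic, SAME plaquette radius as `V`,
  and an EXACT right inverse of the `k`-fold average (43): `avgIter L ((slicePull L)^[k] V) k = V` (`avgIter_slicePullIter`; so (43) is onto, `exists_avgIter_eq`).  Hence for EVERY `V ∈ sfClass d L N ε₁ 0`, `ε₁ ≥ 0`, the
  admissible set of run `k` at the INFLATED radius `ε₁·(L^k)²` is NON-EMPTY (`slicePullIter_mem_admissible`, `nonempty_admissible_inflated`), and by leaf-05's compactness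
  ★ `exists_isMinimiser_inflated`: a minimiser of run `k` over `sfClass d L N e` EXISTS at every datum of `sfClass d L N ε₁ 0` as soon as `ε₁(L^k)² ≤ e` and `e` is in the series
  regime (`16C₀e ≤ 3`, `1024(d+1)(d+4)L²e ≤ 1`, `L ≥ 2`).  `exists8Min_inflated` is (T8)'s binder text at the k-DEPENDENT constant `B₃(k) := (L^{k+1})²` (per `k`, under that regime):
  (8)'s existence clause with a constant depending on `k` is a THEOREM at the (42)-objects, so the located content of (T8) — [Balaban1985Variational] Thm 1 «the constants a₀, a₁, B₃
  depend on d and L only» (p. 279) — is EXACTLY the k-UNIFORMITY of `B₃`, nothing else.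
* §2 ON THE FLAT MODULI.  `(slicePull L)^[k] V` is flat, lies in `sfClass d L N e k` for EVERY `e ≥ 0`, and has level action `0`; hence ★ `isMinimiser_slicePullIter_of_flat` ((T8) on the
  moduli, every run, every radius `e ≥ 0`, no regime); every minimiser at a flat datum has action `≤ 0`, hence `= 0` (`levelAction_eq_zero_of_isMinimiser_flat`), hence is FLAT
  (`flat_of_isMinimiser_flat`; ★ `isMinimiser_iff_admissible_and_flat`: at a flat datum the minimisers are EXACTLY the admissible flat configurations), hence a pure gauge `1^{g}` on `ℤ^d` with `g` unitary (NOT periodic in general — the holonomy), hence in `lipGauge` with ALL RADII `0` on EVERY cube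
  (`lipGauge_zero_of_flat`), hence ★ `regularity_of_isMinimiser_flatData`: `B11.Regularity (torusVP d L N (lipGauge d n) k) B₃ B₄ ε₁ U (y, K)` for all `0 < B₃, B₄, ε₁` and every cube.
* §3 ★ `reg910Slot_on_flatData` · `exists8Min_on_flatData` · ★★ `slotKey_bundle_on_flatData` — file 11's three texts VERBATIM with `{flatCfg}` replaced by `sfClass d L N 0 0`.

CONSEQUENCE (for cdisprove and the planners; no re-cut asked).  A refutation of dag-n16-e's ∕ this seat's DischargeTest v6 ∕ v6L `stub_reg910Slot` must use a datum with a
NON-TRIVIAL PLAQUETTE (holonomy alone cannot do it: §3), and an attack on its existence half at any FIXED run length is answered by `B₃(k)` (§1): only the UNIFORMITY in `k` of the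
class constant is content.  Nothing here bears on node N19 ∕ N21's radius-floor question ((t-N16b)).

HONEST FRAMING.  Hypothesis-free kernel facts about the ZERO-CURVATURE sector and about (8) at a k-DEPENDENT radius, over landed `pub-balaban` ∕ dag-n16-w1 lemmas BY NAME; they
inhabit the CONCLUSION SHAPE of the re-keyed in-edge where it is free and say NOTHING about non-flat loose data at a k-uniform `B₃` — node N07's content ([Balaban1985Variational]
Thm 1 (8)–(10) p. 279 at the (42)-objects), NOT asserted, NOT refuted; `stub_h7` ∕ `stub_reg910Slot` ∕ `stub_lettersB9Src` NOT closed; no registered stub of K3⁷ v5 (`stub_rates13H`,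
`stub_expansion13H`) named or closed; N16 ∕ N07 ∕ N19 NOT discharged; count-neutral; counts of record unmoved (typed 28∕28 · discharged 5∕28); one finite four-torus at fixed `ε`,
Bałaban AS PRINTED — NOT ℝ⁴, NOT infinite volume, NOT OS, NOT a mass gap; the YM mass gap (Clay) is NOT proved by any of this — R4 closes the conditional finite-𝕋⁴ rung
`BalabanLadder.UV` only.
-/

set_option autoImplicit false

open scoped BigOperators Matrix Matrix.Norms.L2Operator
open NormedSpace

namespace Summit.QuantumFields.YangMills.BalabanUVNodes.N16SlotKeyFlatModuli

open Literature.MathematicalPhysics.QuantumFieldTheory.Balaban1983to89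
open B7Prop1Explicit B7Prop2Explicit MatrixLog UnitaryModel
open T4AveragingDeficitWall hiding Site Plane Plaq Bond
open T4AveragingDeficitWallBoundary (IsPeriodicCfg)
open B7Prop1Local (hol_plaqWord_eq)
open Summit.QuantumFields.BalabanUV.T4Continuum
open AveragingDeficitLatticeH2Prep (fd)
open MinimalActionLevels (levelAction levelAction_nonneg perWin)
open MinimalActionSandwich (IsMinimiser admissible)
open MinimalActionRate (sfClass)
open MinimalActionDictionary (torusVP RadiiMono)
open MinimalActionWitness (flatCfg flatCfg_mem_sfClass)
open MinimalActionExistence (exists_isMinimiser_of_nonempty)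
open NE3EnergyRateFlatClass (hol_plaqWord_eq_one_of_levelAction_eq_zero exists_unitary_gauge_eq_gaugeAct_flatCfg)
open NE7InteriorInduction (isUnitaryCfg_slicePull isPeriodicCfg_slicePull smallField_slicePull avgIter_slicePull_succ)
open SmoothRefineBlocks (slicePull)
open B11 (Regularity)
open Summit.QuantumFields.YangMills.BalabanUVNodes.N16H7OfN07RecordSlot (lipGauge radiiMono_lipGauge' interface_lipGauge')
open Summit.QuantumFields.YangMills.BalabanUVNodes.N16SlotKeyWitnesses (lipGauge_gaugeAct_flatCfg regularity_torusVP_lipGauge_of_zero)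

noncomputable section

variable {d : ℕ} {n : Type} [Fintype n] [DecidableEq n]

/-! ## §0 The flat moduli `sfClass d L N 0 0` in words -/

/-- **SMALL FIELD OF RADIUS `0` = ZERO CURVATURE**: `SmallField U 0` iff every unit plaquette variable of `U` is `1` (both orientations). [folklore] -/
theorem smallField_zero_iff_flat (U : Site d → Fin d → (Matrix n n ℂ)ˣ) :
    SmallField U 0 ↔ ∀ (x : Site d) (κ μ : Fin d), κ ≠ μ → hol U x (plaqWord κ μ) = 1 := by
  refine ⟨fun h x κ μ hκμ => ?_, fun h x κ μ hκμ => ?_⟩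
  · have h1 : ((hol U x (plaqWord κ μ) : (Matrix n n ℂ)ˣ) : Matrix n n ℂ) = 1 := by
      rw [← sub_eq_zero]; exact norm_le_zero_iff.mp (h x κ μ hκμ)
    exact Units.ext h1
  · rw [h x κ μ hκμ, Units.val_one, sub_self, norm_zero]

/-- **THE FLAT MODULI IN WORDS**: `V ∈ sfClass d L N 0 0` iff `V` is `U(N)`-valued, `N`-periodic and every unit plaquette variable of `V` is `1` — ALL flat unit-lattice data on the torus
of side `N`: pure gauges of `1` AND the flat connections with non-trivial holonomy along the torus cycles. [cite: Balaban1985Variational, (6)–(7) p.278] -/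
theorem mem_sfClass_zero_zero_iff {L N : ℕ} (V : Site d → Fin d → (Matrix n n ℂ)ˣ) :
    V ∈ sfClass d L N 0 0 ↔ IsUnitaryCfg V ∧ IsPeriodicCfg V (N : ℤ) ∧ ∀ (x : Site d) (κ μ : Fin d), κ ≠ μ → hol V x (plaqWord κ μ) = 1 := by
  simp only [sfClass, Set.mem_setOf_eq, pow_zero, mul_one, one_pow, div_one, smallField_zero_iff_flat]

/-- `flatCfg ∈ sfClass d L N 0 0` (`MinimalActionWitness.flatCfg_mem_sfClass` at radius `0`): file 11's datum is a point of the moduli. [folklore] -/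
theorem flatCfg_mem_sfClass_zero (L N : ℕ) : (flatCfg : Site d → Fin d → (Matrix n n ℂ)ˣ) ∈ sfClass d L N 0 0 :=
  flatCfg_mem_sfClass L N le_rfl 0

/-- **CONSTANT COMMUTING DATA ARE IN THE FLAT MODULI**: for pairwise commuting unitary `c_κ`, the constant configuration `V(x, κ) = c_κ` is `U(N)`-valued, `N`-periodic for every `N`,
and flat (`V(∂p) = c_κ c_μ c_κ⁻¹ c_μ⁻¹ = 1`).  Its holonomy along the `κ`-cycle of the torus of side `N` is `c_κ^N` (`hol_constCfg_seg`), which need not be `1` — such data are not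
`N`-periodic pure gauges of `1` (`constCfg_ne_gaugeAct_flatCfg`). [folklore] -/
theorem constCfg_mem_sfClass_zero (L N : ℕ) (c : Fin d → (Matrix n n ℂ)ˣ) (hc : ∀ κ, c κ ∈ unitaryUnits (Matrix n n ℂ))
    (hcomm : ∀ κ μ, c κ * c μ = c μ * c κ) :
    (fun (_ : Site d) (κ : Fin d) => c κ) ∈ sfClass d L N 0 0 := by
  rw [mem_sfClass_zero_zero_iff]
  refine ⟨fun _ κ => hc κ, fun _ _ _ => rfl, fun x κ μ _ => ?_⟩
  rw [hol_plaqWord_eq, hcomm κ μ, mul_inv_cancel_right, mul_inv_cancel]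

/-- The holonomy of the constant configuration `V(x, μ) = c_μ` along the straight contour of `N` steps in direction `κ` is `c_κ^N`. [folklore] -/
theorem hol_constCfg_seg (c : Fin d → (Matrix n n ℂ)ˣ) (x : Site d) (κ : Fin d) :
    ∀ N : ℕ, hol (fun (_ : Site d) (μ : Fin d) => c μ) x (seg κ (N : ℤ)) = c κ ^ N
  | 0 => by simp
  | N + 1 => by
      rw [Nat.cast_succ, hol_seg_succ, hol_constCfg_seg c x κ N, pow_succ]

/-- An `N`-periodic pure gauge of `1` has TRIVIAL holonomy along every torus cycle: `1^{g}(x → x + N e_κ) = g(x)·g(x + N e_κ)⁻¹ = 1` (`hol_gaugeAct`, `hol_flat`).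
`IsPeriodicSite` is node NE3's periodicity predicate for site fields. [folklore] -/
theorem hol_gaugeAct_flatCfg_seg_period {g : Site d → (Matrix n n ℂ)ˣ} {N : ℕ} (hg : NE3EnergyShapes.IsPeriodicSite g (N : ℤ)) (x : Site d) (κ : Fin d) :
    hol (gaugeAct g (flatCfg : Site d → Fin d → (Matrix n n ℂ)ˣ)) x (seg κ (N : ℤ)) = 1 := by
  have h1 : hol (flatCfg : Site d → Fin d → (Matrix n n ℂ)ˣ) x (seg κ (N : ℤ)) = 1 := hol_flat _ _
  rw [hol_gaugeAct, disp_seg, hg x κ, h1, mul_one, mul_inv_cancel]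

/-- **THE FLAT MODULI IS STRICTLY LARGER THAN THE PERIODIC PURE-GAUGE ORBIT OF `1`** (certifying the remark of `constCfg_mem_sfClass_zero`): a constant datum `c` with `c_κ^N ≠ 1` for
some direction `κ` is NOT `1^{g}` for any `N`-periodic site gauge `g` — the cycle holonomy `c_κ^N` is an invariant of `N`-periodic gauges.  (With §0: for commuting unitary such `c` the
datum is a point of `sfClass d L N 0 0` outside file 11's orbit, e.g. `d ≥ 1`, `N ≥ 1`, `c_κ = ζ·1` with `ζ^N ≠ 1`.) [folklore] -/
theorem constCfg_ne_gaugeAct_flatCfg {N : ℕ} (c : Fin d → (Matrix n n ℂ)ˣ) {κ : Fin d} (hκ : c κ ^ N ≠ 1)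
    {g : Site d → (Matrix n n ℂ)ˣ} (hg : NE3EnergyShapes.IsPeriodicSite g (N : ℤ)) :
    (fun (_ : Site d) (μ : Fin d) => c μ) ≠ gaugeAct g flatCfg := by
  intro h
  have h1 := hol_constCfg_seg c 0 κ N
  rw [h, hol_gaugeAct_flatCfg_seg_period hg 0 κ] at h1
  exact hκ h1.symm

/-! ## §1 The iterated slice pullback: an exact right inverse of the `k`-fold average (43); (8) at the inflated radius -/

/-- The iterate unfolds on the outside: `(slicePull L)^[k+1] V = slicePull L ((slicePull L)^[k] V)`. [folklore] -/
theorem slicePullIter_succ (L : ℕ) (V : Site d → Fin d → (Matrix n n ℂ)ˣ) (k : ℕ) :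
    (slicePull L)^[k + 1] V = slicePull L ((slicePull L)^[k] V) :=
  Function.iterate_succ_apply' (slicePull L) k V

/-- The iterated slice pullback of a `U(N)`-valued configuration is `U(N)`-valued. [folklore] -/
theorem isUnitaryCfg_slicePullIter (L : ℕ) {V : Site d → Fin d → (Matrix n n ℂ)ˣ} (hV : IsUnitaryCfg V) :
    ∀ k : ℕ, IsUnitaryCfg ((slicePull L)^[k] V)
  | 0 => hV
  | k + 1 => by
      rw [slicePullIter_succ]
      exact isUnitaryCfg_slicePull L (isUnitaryCfg_slicePullIter L hV k)

/-- The `k`-fold slice pullback of an `N`-periodic configuration is `(N·L^k)`-periodic (`L ≥ 1`). [folklore] -/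
theorem isPeriodicCfg_slicePullIter {L : ℕ} (hL : 1 ≤ L) {N : ℕ} {V : Site d → Fin d → (Matrix n n ℂ)ˣ} (hV : IsPeriodicCfg V (N : ℤ)) :
    ∀ k : ℕ, IsPeriodicCfg ((slicePull L)^[k] V) ((N * L ^ k : ℕ) : ℤ)
  | 0 => by simpa using hV
  | k + 1 => by
      rw [slicePullIter_succ]
      have e : ((N * L ^ (k + 1) : ℕ) : ℤ) = (L : ℤ) * ((N * L ^ k : ℕ) : ℤ) := by push_cast; ring
      rw [e]
      exact isPeriodicCfg_slicePull hL (isPeriodicCfg_slicePullIter hL hV k)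

/-- **SAME PLAQUETTE RADIUS**: `SmallField V a`, `0 ≤ a` ⟹ `SmallField ((slicePull L)^[k] V) a` for every `k` — the fine plaquettes of a pullback are corner pullbacks of the coarse
ones or `1` (`NE7InteriorInduction.smallField_slicePull`, iterated). [folklore] -/
theorem smallField_slicePullIter {L : ℕ} (hL : 1 ≤ L) {V : Site d → Fin d → (Matrix n n ℂ)ˣ} {a : ℝ} (ha : 0 ≤ a) (hV : SmallField V a) :
    ∀ k : ℕ, SmallField ((slicePull L)^[k] V) a
  | 0 => hV
  | k + 1 => by
      rw [slicePullIter_succ]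
      exact smallField_slicePull hL ha (smallField_slicePullIter hL ha hV k)

/-- **★ THE ITERATED SLICE PULLBACK IS AN EXACT RIGHT INVERSE OF THE `k`-FOLD AVERAGE (43)**: `avgIter L ((slicePull L)^[k] V) k = V` (`L ≥ 1`; one step is
`NE7InteriorInduction.avgIter_slicePull_succ` — the loop variables of (42) are trivial on a pullback and the straight contour reads the coarse bond).  In particular the `k`-fold
average (43) is SURJECTIVE onto all unit-lattice configurations. [cite: Balaban1985Averaging, (42)–(43) pp.23–24] -/
theorem avgIter_slicePullIter {L : ℕ} (hL : 1 ≤ L) (V : Site d → Fin d → (Matrix n n ℂ)ˣ) :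
    ∀ k : ℕ, avgIter L ((slicePull L)^[k] V) k = V
  | 0 => rfl
  | k + 1 => by rw [slicePullIter_succ, avgIter_slicePull_succ hL, avgIter_slicePullIter hL V k]

/-- Hence **THE `k`-FOLD AVERAGE (43) IS ONTO**: every unit-lattice configuration is the `k`-fold average of some configuration of the `L^k`-times finer lattice (`L ≥ 1`). [folklore] -/
theorem exists_avgIter_eq {L : ℕ} (hL : 1 ≤ L) (V : Site d → Fin d → (Matrix n n ℂ)ˣ) (k : ℕ) :
    ∃ U : Site d → Fin d → (Matrix n n ℂ)ˣ, avgIter L U k = V :=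
  ⟨_, avgIter_slicePullIter hL V k⟩

/-- **THE ITERATED PULLBACK IS IN THE LEVEL-`k` CLASS AT ANY RADIUS `e ≥ a·(L^k)²`**: a unitary `N`-periodic `V` with `SmallField V a`, `0 ≤ a`, has `(slicePull L)^[k] V ∈ sfClass d L N e k`
whenever `a ≤ e∕(L^k)²`. [folklore] -/
theorem slicePullIter_mem_sfClass {L : ℕ} (hL : 1 ≤ L) {N : ℕ} {V : Site d → Fin d → (Matrix n n ℂ)ˣ} (hVu : IsUnitaryCfg V) (hVp : IsPeriodicCfg V (N : ℤ))
    {a e : ℝ} (ha : 0 ≤ a) (hVa : SmallField V a) (k : ℕ) (hae : a ≤ e / ((L : ℝ) ^ k) ^ 2) :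
    (slicePull L)^[k] V ∈ sfClass d L N e k :=
  ⟨isUnitaryCfg_slicePullIter L hVu k, isPeriodicCfg_slicePullIter hL hVp k,
    MinimalActionRate.SmallField.mono (smallField_slicePullIter hL ha hVa k) hae⟩

/-- **… AND ADMISSIBLE FOR THE DATUM `V` ITSELF** (its `k`-fold average is `V`). [folklore] -/
theorem slicePullIter_mem_admissible {L : ℕ} (hL : 1 ≤ L) {N : ℕ} {V : Site d → Fin d → (Matrix n n ℂ)ˣ} (hVu : IsUnitaryCfg V) (hVp : IsPeriodicCfg V (N : ℤ))
    {a e : ℝ} (ha : 0 ≤ a) (hVa : SmallField V a) (k : ℕ) (hae : a ≤ e / ((L : ℝ) ^ k) ^ 2) :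
    (slicePull L)^[k] V ∈ admissible (sfClass d L N e) L k V :=
  ⟨slicePullIter_mem_sfClass hL hVu hVp ha hVa k hae, avgIter_slicePullIter hL V k⟩

/-- **★ NON-EMPTINESS AT THE INFLATED RADIUS**: for every datum `V ∈ sfClass d L N ε₁ 0` with `0 ≤ ε₁` and every run length `k`, the admissible set
`{U ∈ sfClass d L N e k ∣ avgIter L U k = V}` is NON-EMPTY as soon as `ε₁·(L^k)² ≤ e` (`L ≥ 1`) — witnessed by the iterated slice pullback.  dag-n16-w1 file 12's «(T8) ⟺ non-emptiness»
therefore locates the content of (T8) in the RADIUS only. [folklore] -/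
theorem nonempty_admissible_inflated {L : ℕ} (hL : 1 ≤ L) {N : ℕ} {ε₁ : ℝ} (hε₁ : 0 ≤ ε₁) {V : Site d → Fin d → (Matrix n n ℂ)ˣ} (hV : V ∈ sfClass d L N ε₁ 0)
    (k : ℕ) {e : ℝ} (he : ε₁ * ((L : ℝ) ^ k) ^ 2 ≤ e) :
    (admissible (sfClass d L N e) L k V).Nonempty := by
  obtain ⟨hVu, hVp, hVa⟩ := hV
  have hVp' : IsPeriodicCfg V (N : ℤ) := by simpa using hVp
  have hVa' : SmallField V ε₁ := by simpa using hVa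
  have hLk : (0 : ℝ) < ((L : ℝ) ^ k) ^ 2 := by
    have hL0 : (0 : ℝ) < L := by exact_mod_cast (show 0 < L by omega)
    positivity
  have hae : ε₁ ≤ e / ((L : ℝ) ^ k) ^ 2 := by rw [le_div_iff₀ hLk]; exact he
  exact ⟨_, slicePullIter_mem_admissible hL hVu hVp' hε₁ hVa' k hae⟩

/-- **★★ (8) AT THE INFLATED RADIUS IS A THEOREM**: for `L ≥ 2`, every datum `V ∈ sfClass d L N ε₁ 0` (`0 ≤ ε₁`), every run length `k` and every class radius `e` with `ε₁·(L^k)² ≤ e`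
in leaf-05's series regime (`16·C₀·e ≤ 3`, `1024(d+1)(d+4)L²·e ≤ 1`), a MINIMISER of run `k` of the Wilson action over `sfClass d L N e` at `V` EXISTS — non-emptiness (above) +
compactness (`MinimalActionExistence.exists_isMinimiser_of_nonempty`).  No regularity, no uniformity: the constant is allowed to grow like `L^{2k}`.
[cite: Balaban1985Variational, Thm 1 (8) p.279] -/
theorem exists_isMinimiser_inflated [Nonempty n] {L : ℕ} (hL : 2 ≤ L) {N : ℕ} {ε₁ : ℝ} (hε₁ : 0 ≤ ε₁) {V : Site d → Fin d → (Matrix n n ℂ)ˣ}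
    (hV : V ∈ sfClass d L N ε₁ 0) (k : ℕ) {e : ℝ} (he : ε₁ * ((L : ℝ) ^ k) ^ 2 ≤ e)
    (he1 : 16 * C0 d * e ≤ 3) (he2 : 1024 * (d + 1) * (d + 4) * (L : ℝ) ^ 2 * e ≤ 1) :
    ∃ U : Site d → Fin d → (Matrix n n ℂ)ˣ, IsMinimiser d (sfClass d L N e) L N k V U := by
  have he0 : 0 ≤ e := le_trans (by positivity) he
  exact exists_isMinimiser_of_nonempty hL he0 he1 he2 (nonempty_admissible_inflated (by omega) hε₁ hV k he)

/-- **(T8)'s BINDER TEXT AT THE k-DEPENDENT CONSTANT `B₃(k) := (L^{k+1})²`, PER `k`** (`L ≥ 2`; threshold `a` with `16·C₀·(L^{k+1})²·a ≤ 3`, `1024(d+1)(d+4)L²·(L^{k+1})²·a ≤ 1`): for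
every `0 < ε₁ ≤ a` and every `V ∈ sfClass d L N ε₁ 0` SOME minimiser of run `k+1` over `sfClass d L N ((L^{k+1})²·ε₁)` at `V` exists.  The slot key's (T8) asks the same with ONE
`B₃` for ALL `k` ([Balaban1985Variational] Thm 1: «B₃ depends on d and L only», p. 279) — that uniformity, and nothing else, is its located content.
[cite: Balaban1985Variational, Thm 1 (8) p.279] -/
theorem exists8Min_inflated [Nonempty n] {L : ℕ} (hL : 2 ≤ L) (N k : ℕ) {a : ℝ}
    (ha1 : 16 * C0 d * (((L : ℝ) ^ (k + 1)) ^ 2 * a) ≤ 3) (ha2 : 1024 * (d + 1) * (d + 4) * (L : ℝ) ^ 2 * (((L : ℝ) ^ (k + 1)) ^ 2 * a) ≤ 1) :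
    ∀ ε₁ : ℝ, 0 < ε₁ → ε₁ ≤ a → ∀ V : Site d → Fin d → (Matrix n n ℂ)ˣ, V ∈ sfClass d L N ε₁ 0 →
      ∃ U : Site d → Fin d → (Matrix n n ℂ)ˣ, IsMinimiser d (sfClass d L N (((L : ℝ) ^ (k + 1)) ^ 2 * ε₁)) L N (k + 1) V U := by
  intro ε₁ hε₁ hε₁a V hV
  have hL0 : (0 : ℝ) < L := by exact_mod_cast (show 0 < L by omega)
  have hB : 0 ≤ ((L : ℝ) ^ (k + 1)) ^ 2 := by positivity
  have hmono : ((L : ℝ) ^ (k + 1)) ^ 2 * ε₁ ≤ ((L : ℝ) ^ (k + 1)) ^ 2 * a := mul_le_mul_of_nonneg_left hε₁a hB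
  have hC0 : 0 ≤ 16 * C0 d := by have := C0_pos d; positivity
  refine exists_isMinimiser_inflated hL hε₁.le hV (k + 1) (le_of_eq (mul_comm _ _)) ?_ ?_
  · exact (mul_le_mul_of_nonneg_left hmono hC0).trans ha1
  · exact (mul_le_mul_of_nonneg_left hmono (by positivity)).trans ha2

/-! ## §2 On the flat moduli: the pullback minimises with action `0`; every minimiser is flat, a pure gauge, and (9)–(10)-regular with all radii `0` -/

/-- **ZERO CURVATURE ⇒ ZERO LEVEL ACTION**: a configuration with `SmallField U 0` has `A^{(k)}(U) = 0` for every `L, N, k` (every Wilson weight `1 − Re tr U(∂p)` is `1 − Re tr 1 = 0`).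
[cite: Balaban1985Variational, (5) p.278] -/
theorem levelAction_eq_zero_of_smallField_zero [Nonempty n] (L N k : ℕ) {U : Site d → Fin d → (Matrix n n ℂ)ˣ} (hU : SmallField U 0) :
    levelAction d L N k U = 0 := by
  have hflat := (smallField_zero_iff_flat U).mp hU
  have hfa : fineAction U (perWin d (N * L ^ k)) = 0 := by
    unfold fineAction
    refine Finset.sum_eq_zero fun p _ => ?_
    have hp : fhol U p = 1 := hflat p.1 p.2.1.1 p.2.1.2 (ne_of_lt p.2.2)
    rw [hp, wt_one]
  unfold levelAction
  rw [hfa, mul_zero]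

/-- **THE ITERATED PULLBACK OF A FLAT DATUM IS ADMISSIBLE AT EVERY RADIUS `e ≥ 0`** (it is flat: plaquette radius `0 ≤ e∕(L^k)²`). [folklore] -/
theorem slicePullIter_mem_admissible_of_flat {L : ℕ} (hL : 1 ≤ L) {N : ℕ} {V : Site d → Fin d → (Matrix n n ℂ)ˣ} (hV : V ∈ sfClass d L N 0 0)
    {e : ℝ} (he : 0 ≤ e) (k : ℕ) :
    (slicePull L)^[k] V ∈ admissible (sfClass d L N e) L k V := by
  obtain ⟨hVu, hVp, hVa⟩ := hV
  have hVp' : IsPeriodicCfg V (N : ℤ) := by simpa using hVp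
  have hVa' : SmallField V 0 := by simpa using hVa
  exact slicePullIter_mem_admissible hL hVu hVp' le_rfl hVa' k (by positivity)

/-- The iterated pullback of a flat datum is flat (plaquette radius `0` is preserved). [folklore] -/
theorem smallField_zero_slicePullIter_of_flat {L : ℕ} (hL : 1 ≤ L) {N : ℕ} {V : Site d → Fin d → (Matrix n n ℂ)ˣ} (hV : V ∈ sfClass d L N 0 0) (k : ℕ) :
    SmallField ((slicePull L)^[k] V) 0 := by
  have hVa' : SmallField V 0 := by simpa using hV.2.2
  exact smallField_slicePullIter hL le_rfl hVa' k

/-- **★ (T8) ON THE FLAT MODULI, EVERY RUN, EVERY RADIUS, NO REGIME**: for `L ≥ 1`, `e ≥ 0` and every `V ∈ sfClass d L N 0 0`, the iterated slice pullback `(slicePull L)^[k] V`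
MINIMISES run `k` of the Wilson action over `sfClass d L N e` at `V` — it is admissible with action `0`, and every `U(N)`-valued action is `≥ 0`.
[cite: Balaban1985Variational, Thm 1 (8) p.279] -/
theorem isMinimiser_slicePullIter_of_flat [Nonempty n] {L : ℕ} (hL : 1 ≤ L) {N : ℕ} {V : Site d → Fin d → (Matrix n n ℂ)ˣ} (hV : V ∈ sfClass d L N 0 0)
    {e : ℝ} (he : 0 ≤ e) (k : ℕ) :
    IsMinimiser d (sfClass d L N e) L N k V ((slicePull L)^[k] V) where
  mem := slicePullIter_mem_admissible_of_flat hL hV he k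
  le := fun U' hU' => by
    rw [levelAction_eq_zero_of_smallField_zero L N k (smallField_zero_slicePullIter_of_flat hL hV k)]
    exact levelAction_nonneg L N k hL hU'.1.1

/-- **EVERY MINIMISER AT A FLAT DATUM HAS ZERO ACTION** (`L ≥ 1`, `e ≥ 0`): its action is at most that of the flat competitor `(slicePull L)^[k] V`, i.e. `≤ 0`, and `≥ 0`. [folklore] -/
theorem levelAction_eq_zero_of_isMinimiser_flat [Nonempty n] {L : ℕ} (hL : 1 ≤ L) {N : ℕ} {V : Site d → Fin d → (Matrix n n ℂ)ˣ} (hV : V ∈ sfClass d L N 0 0)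
    {e : ℝ} (he : 0 ≤ e) {k : ℕ} {U : Site d → Fin d → (Matrix n n ℂ)ˣ} (hU : IsMinimiser d (sfClass d L N e) L N k V U) :
    levelAction d L N k U = 0 := by
  refine le_antisymm ?_ (levelAction_nonneg L N k hL hU.mem.1.1)
  have h := hU.le _ (slicePullIter_mem_admissible_of_flat hL hV he k)
  rwa [levelAction_eq_zero_of_smallField_zero L N k (smallField_zero_slicePullIter_of_flat hL hV k)] at h

/-- **★ EVERY MINIMISER AT A FLAT DATUM IS FLAT** (`L, N ≥ 1`, `e ≥ 0`): zero action ⇒ zero curvature on the whole of `ℤ^d` (`NE3EnergyRateFlatClass.hol_plaqWord_eq_one_of_levelAction_eq_zero`: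
the period window carries one representative of every plaquette).  So at flat data the (8)-class minimisers of every run are exactly the admissible FLAT configurations — minimality
and regularity carry no content there. [folklore] -/
theorem flat_of_isMinimiser_flat [Nonempty n] {L N : ℕ} (hL : 1 ≤ L) (hN : 1 ≤ N) {V : Site d → Fin d → (Matrix n n ℂ)ˣ} (hV : V ∈ sfClass d L N 0 0)
    {e : ℝ} (he : 0 ≤ e) {k : ℕ} {U : Site d → Fin d → (Matrix n n ℂ)ˣ} (hU : IsMinimiser d (sfClass d L N e) L N k V U) :
    ∀ (x : Site d) (κ μ : Fin d), κ ≠ μ → hol U x (plaqWord κ μ) = 1 :=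
  hol_plaqWord_eq_one_of_levelAction_eq_zero hL hN hU.mem.1.1 hU.mem.1.2.1 (levelAction_eq_zero_of_isMinimiser_flat hL hV he hU)

/-- … equivalently: the minimiser lies in the level-`k` flat moduli `sfClass d L N 0 k`. [folklore] -/
theorem mem_sfClass_zero_of_isMinimiser_flat [Nonempty n] {L N : ℕ} (hL : 1 ≤ L) (hN : 1 ≤ N) {V : Site d → Fin d → (Matrix n n ℂ)ˣ} (hV : V ∈ sfClass d L N 0 0)
    {e : ℝ} (he : 0 ≤ e) {k : ℕ} {U : Site d → Fin d → (Matrix n n ℂ)ˣ} (hU : IsMinimiser d (sfClass d L N e) L N k V U) :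
    U ∈ sfClass d L N 0 k := by
  refine ⟨hU.mem.1.1, hU.mem.1.2.1, ?_⟩
  rw [zero_div]
  exact (smallField_zero_iff_flat U).mpr (flat_of_isMinimiser_flat hL hN hV he hU)

/-- **★ AT A FLAT DATUM THE MINIMISERS ARE EXACTLY THE ADMISSIBLE FLAT CONFIGURATIONS** (`L, N ≥ 1`, `e ≥ 0`, `V ∈ sfClass d L N 0 0`): `U` minimises run `k` over `sfClass d L N e` at `V`
iff `U` is admissible (class member with `k`-fold average `V`) and has zero curvature.  Minimality carries no content on the flat moduli. [folklore] -/
theorem isMinimiser_iff_admissible_and_flat [Nonempty n] {L N : ℕ} (hL : 1 ≤ L) (hN : 1 ≤ N) {V : Site d → Fin d → (Matrix n n ℂ)ˣ} (hV : V ∈ sfClass d L N 0 0)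
    {e : ℝ} (he : 0 ≤ e) (k : ℕ) (U : Site d → Fin d → (Matrix n n ℂ)ˣ) :
    IsMinimiser d (sfClass d L N e) L N k V U ↔ U ∈ admissible (sfClass d L N e) L k V ∧ SmallField U 0 := by
  refine ⟨fun hU => ⟨hU.mem, (smallField_zero_iff_flat U).mpr (flat_of_isMinimiser_flat hL hN hV he hU)⟩, fun ⟨hmem, hflat⟩ => ⟨hmem, fun U' hU' => ?_⟩⟩
  rw [levelAction_eq_zero_of_smallField_zero L N k hflat]
  exact levelAction_nonneg L N k hL hU'.1.1

/-- **A FLAT `U(N)`-VALUED CONFIGURATION LIES IN THE (9)_{β₀=1} SUP SHAPE ON EVERY CUBE WITH ALL RADII `0`**: zero curvature ⇒ `U = 1^{g}` on `ℤ^d` with `g` unitary (the complete axial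
gauge, `NE3EnergyRateFlatClass.exists_unitary_gauge_eq_gaugeAct_flatCfg`; `g` is NOT periodic in general — it carries the holonomy), and a unitary pure gauge of `1` is in `lipGauge`
with radii `0, 0, 0` (file 11 `lipGauge_gaugeAct_flatCfg`, which never uses periodicity of `g`). [folklore] -/
theorem lipGauge_zero_of_flat [Nonempty n] {U : Site d → Fin d → (Matrix n n ℂ)ˣ} (hU : IsUnitaryCfg U)
    (hflat : ∀ (x : Site d) (κ μ : Fin d), κ ≠ μ → hol U x (plaqWord κ μ) = 1) (y : Site d) (K : ℕ) :
    lipGauge d n U y K 0 0 0 := by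
  obtain ⟨g, hg, hUg⟩ := exists_unitary_gauge_eq_gaugeAct_flatCfg hU hflat
  rw [hUg]
  exact lipGauge_gaugeAct_flatCfg hg y K

/-- **★ EVERY MINIMISER AT A FLAT DATUM IS (9)–(10)-REGULAR ON EVERY CUBE.**  For `L, N ≥ 1`, `e ≥ 0`, every `V ∈ sfClass d L N 0 0` and all `0 < B₃, B₄, ε₁`: every minimiser `U` of run `k`
of the Wilson action over `sfClass d L N e` at `V` satisfies `B11.Regularity (torusVP d L N (lipGauge d n) k) B₃ B₄ ε₁ U (y, K)` for EVERY cube `(y, K)` — flat ⇒ pure gauge ⇒ radii `0` ⇒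
file 11's `regularity_torusVP_lipGauge_of_zero`.  File 11's `regularity_of_isMinimiser_flatCfg` is the case `V = flatCfg`. [cite: Balaban1985Variational, Thm 1 (9)–(10) p.279] -/
theorem regularity_of_isMinimiser_flatData [Nonempty n] {L N k : ℕ} (hL : 1 ≤ L) (hN : 1 ≤ N) {V : Site d → Fin d → (Matrix n n ℂ)ˣ} (hV : V ∈ sfClass d L N 0 0)
    {e : ℝ} (he : 0 ≤ e) {B₃ B₄ ε₁ : ℝ} (hB₃ : 0 < B₃) (hB₄ : 0 < B₄) (hε₁ : 0 < ε₁)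
    {U : Site d → Fin d → (Matrix n n ℂ)ˣ} (hU : IsMinimiser d (sfClass d L N e) L N k V U) (y : Site d) (K : ℕ) :
    Regularity (torusVP d L N (lipGauge d n) k) B₃ B₄ ε₁ U (y, K) :=
  regularity_torusVP_lipGauge_of_zero hL hB₃ hB₄ hε₁ (lipGauge_zero_of_flat hU.mem.1.1 (flat_of_isMinimiser_flat hL hN hV he hU) y K)

/-! ## §3 (T9ˢ), (T8) and the re-keyed binder bundle on the flat moduli (file 11's texts with `{flatCfg}` ↦ `sfClass d L N 0 0`) -/

/-- **★ (T9ˢ) ON THE FLAT MODULI** — the slot key's regularity clause (dag-n16-w1 file 9 §1's `hR`, binder for binder) with the datum ranging over `sfClass d L N 0 0`, at the shape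
`lipGauge` and EVERY `C : B11Thm1.Consts`: for every run `k+1`, `0 < ε₁ ≤ a₁`, flat `V`, every minimiser `U` over `sfClass d L N (B₃ε₁) (k+1)` at `V` and every site `x`, `Regularity` on the
collar-slot cube `(x, L^{k+1} − 1 + L^{k+1} + 2)` (indeed on every cube, §2).  `L, N ≥ 1`. [cite: Balaban1985Variational, Thm 1 (9)–(10) p.279] -/
theorem reg910Slot_on_flatData [Nonempty n] {L N : ℕ} (hL : 1 ≤ L) (hN : 1 ≤ N) (C : B11Thm1.Consts) :
    ∀ (k : ℕ) (ε₁ : ℝ), 0 < ε₁ → ε₁ ≤ C.a₁ → ∀ (V U : Site d → Fin d → (Matrix n n ℂ)ˣ), V ∈ sfClass d L N 0 0 →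
      IsMinimiser d (sfClass d L N (C.B₃ * ε₁)) L N (k + 1) V U →
        ∀ x : Site d, Regularity (torusVP d L N (lipGauge d n) (k + 1)) C.B₃ C.B₄ ε₁ U (x, L ^ (k + 1) - 1 + L ^ (k + 1) + 2) := by
  intro k ε₁ hε₁ _ V U hV hU x
  exact regularity_of_isMinimiser_flatData hL hN hV (mul_nonneg C.B₃_pos.le hε₁.le) C.B₃_pos C.B₄_pos hε₁ hU x _

/-- **(T8) ON THE FLAT MODULI** — the slot key's existence clause (file 9 §1's `hE`) at every flat datum: the iterated slice pullback `(slicePull L)^[k+1] V` minimises run `k+1` over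
`sfClass d L N (B₃ε₁) (k+1)` at `V` (§2).  `L ≥ 1`. [cite: Balaban1985Variational, Thm 1 (8) p.279] -/
theorem exists8Min_on_flatData [Nonempty n] {L N : ℕ} (hL : 1 ≤ L) (C : B11Thm1.Consts) :
    ∀ (k : ℕ) (ε₁ : ℝ), 0 < ε₁ → ε₁ ≤ C.a₁ → ∀ V : Site d → Fin d → (Matrix n n ℂ)ˣ, V ∈ sfClass d L N 0 0 →
      ∃ U : Site d → Fin d → (Matrix n n ℂ)ˣ, IsMinimiser d (sfClass d L N (C.B₃ * ε₁)) L N (k + 1) V U := by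
  intro k ε₁ hε₁ _ V hV
  exact ⟨_, isMinimiser_slicePullIter_of_flat hL hV (mul_nonneg C.B₃_pos.le hε₁.le) (k + 1)⟩

/-- **★★ THE RE-KEYED N07 IN-EDGE BUNDLE, RESTRICTED TO THE FLAT MODULI, IS INHABITED** (every `C : B11Thm1.Consts`; `L, N ≥ 1`): the local-gauge shape `G := lipGauge d n` is monotone in
its radii (`hGm`), meets the (9)_{β₀=1} interface (`hG`), and satisfies (T9ˢ) and (T8) with the datum ranging over `sfClass d L N 0 0` = ALL flat unit-lattice data of the torus (pure
gauges AND non-trivial holonomies) — file 11's `slotKey_bundle_on_flat` is its restriction to `{flatCfg}`.  So a refutation of DischargeTest v6∕v6L's `stub_reg910Slot` needs a datum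
with a non-trivial plaquette; the only open content of the re-keyed in-edge is the non-flat loose data at a k-uniform `B₃` (node N07). [folklore] -/
theorem slotKey_bundle_on_flatData [Nonempty n] {L N : ℕ} (hL : 1 ≤ L) (hN : 1 ≤ N) (C : B11Thm1.Consts) :
    ∃ G : (Site d → Fin d → (Matrix n n ℂ)ˣ) → Site d → ℕ → ℝ → ℝ → ℝ → Prop,
      RadiiMono d G ∧
      (∀ (U : Site d → Fin d → (Matrix n n ℂ)ˣ) (x : Site d) (K : ℕ) (α₀ α₁ α₂ : ℝ), 2 ≤ K → G U x K α₀ α₁ α₂ →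
        ∃ (u : Site d → (Matrix n n ℂ)ˣ) (a : Site d → Fin d → Matrix n n ℂ),
          (∀ z, u z ∈ unitaryUnits (Matrix n n ℂ)) ∧
          (∀ (y : Site d) (τ : Fin d), l1 (y - x) ≤ 2 → ((gaugeAct u U y τ : (Matrix n n ℂ)ˣ) : Matrix n n ℂ) = exp (a y τ)) ∧
          (∀ (y : Site d) (τ : Fin d), l1 (y - x) ≤ 2 → ‖a y τ‖ ≤ α₀) ∧
          (∀ (y : Site d) (τ i : Fin d), l1 (y - x) ≤ 1 → ‖fd i (fun z => a z τ) y‖ ≤ α₁) ∧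
          (∀ (τ i l : Fin d), ‖fd i (fd l (fun z => a z τ)) x‖ ≤ α₂)) ∧
      (∀ (k : ℕ) (ε₁ : ℝ), 0 < ε₁ → ε₁ ≤ C.a₁ → ∀ (V U : Site d → Fin d → (Matrix n n ℂ)ˣ), V ∈ sfClass d L N 0 0 →
        IsMinimiser d (sfClass d L N (C.B₃ * ε₁)) L N (k + 1) V U →
          ∀ x : Site d, Regularity (torusVP d L N G (k + 1)) C.B₃ C.B₄ ε₁ U (x, L ^ (k + 1) - 1 + L ^ (k + 1) + 2)) ∧
      (∀ (k : ℕ) (ε₁ : ℝ), 0 < ε₁ → ε₁ ≤ C.a₁ → ∀ V : Site d → Fin d → (Matrix n n ℂ)ˣ, V ∈ sfClass d L N 0 0 →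
        ∃ U : Site d → Fin d → (Matrix n n ℂ)ˣ, IsMinimiser d (sfClass d L N (C.B₃ * ε₁)) L N (k + 1) V U) :=
  ⟨lipGauge d n, radiiMono_lipGauge', fun U x K α₀ α₁ α₂ hK hG => interface_lipGauge' U x K α₀ α₁ α₂ hK hG,
    reg910Slot_on_flatData hL hN C, exists8Min_on_flatData hL C⟩

end

end Summit.QuantumFields.YangMills.BalabanUVNodes.N16SlotKeyFlatModuli
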